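import Literature.AlgebraicGeometry.Frobenioids.BaseSectionsOfObjectsUniqueness
import Literature.AlgebraicGeometry.Frobenioids.ModelFrobenioidNormalized
import Literature.AlgebraicGeometry.Frobenioids.ModelFrobenioidPullbacks
import Literature.AnabelianGeometry.EtaleTheta.BiKummerOfModelCanonical
import Literature.AnabelianGeometry.EtaleTheta.Discharge.Sec4Prop42Sub
import HarnessLib

/-!
# [EtTh] Prop. 4.2 (iv): the sub-node L06 `ZetaA` DISCHARGED from L05 `UnitRootsUpstairs`
# (base-Frobenius pairs read as in the canonical model instance), and Prop. 4.2 (iv) AS TYPED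
# for `mkOfModelCanonical` modulo L05

Mochizuki, *The étale theta function and its Frobenioid-theoretic manifestations*, Publ. RIMS **45**
(2009), §4, Prop. 4.2 (iv), statement PDF p.89 L1–12, proof p.90 L12–24
[cite: MochizukiEtTh2009, Prop 4.2 p.89]. PROOF-ONLY companion (abc-iut cell; writer abc-iut-w4-d044,
node `EtTh:Prop4.2(iv)`, sub-DAG row `EtTh:Prop4.2(iv)/L06` of `plan/L2/SUBDAG-EtTh-Prop42.md`) of
abc-iut-w5-d134's statements file `Prop42Sub.lean` and companion `Discharge/Sec4Prop42Sub.lean`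
(`prop42_iv_of_zetaA`: Prop. 4.2 (iv) AS TYPED ⇐ L06), over abc-iut-L2-t3's `BiKummerSetting` /
`NthRoot`, abc-iut-L2-t9's `mkOfModelCanonical` (Def. 4.1 (iv)(e) "arise from a base-Frobenius pair"
:= `TemperedFrobenioid.ArisesFromBaseFrobeniusPair` over abc-iut-L1-t2's [FrdI] Def. 2.7
`PreFrobenioid.IsBaseFrobeniusPair`) and the [FrdI] Thm. 5.2 model-Frobenioid bookkeeping of layer L1
(`ModelFrobenioid.exists_iso_comp_eq_of_div_eq`, `isIso_of`, `degFr_div_of_isPullbackMorphism`,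
`isFrobeniusNormalized`, `PreFrobenioid.unit_comp_eq_comp_pow`). Nothing there is edited; no definition
and no named fact is introduced here.

**The printed step** (p.90 L17–21): «the existence of a `ζ_A` as desired follows immediately from the
uniqueness up to conjugation by a unit of base-Frobenius pairs of `A_N`, `Ā_N` [cf. [FrdI], Proposition
5.6], by thinking of `α'', ᾱ''` as categorical quotients [cf. Remark 4.1.1] and applying the
base-triviality and `Aut`-ampleness of the full subcategory of `C` determined by the Frobenius-trivial
objects [cf. [FrdI], Theorem 5.1, (iii)]», the unit being adjusted through «the
"(N, H_⊙, f|_{A_N})-saturated-ness" condition … [cf. also Proposition 3.4, (ii)] … the pull-back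
`∈ O^×(A_N)` … of any element `∈ O^×(A_⊙)` [via the "pull-back portion" of `α`] admits an `N`-th root»
(p.90 L14–17) — the latter is the typed sub-node L05 `Prop42Sub.UnitRootsUpstairs`.

**What is proved** (`Prop42Sub.zetaA_of_unitRootsUpstairs`): for EVERY setting `S` whose Def. 4.1
(iv)(e) predicate `S.ArisesFromBaseFrobeniusPair` implies the reading of the canonical model instance
(`S.tf.ArisesFromBaseFrobeniusPair`: a base-Frobenius pair `(P, F)` of `C` with `α'` `P`-distinguished
and `α'' = F(n)_{A_N}` — definitionally so for `mkOfModelCanonical`), and modulo the standing [FrdI]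
Thm. 5.2 (ii) hypotheses `Φ` divisorial, `B` group-like: L05 ⟹ L06. PROOF. Write `α = α'' ≫ α'`,
`ᾱ = ᾱ'' ≫ ᾱ'` (diagrammatic order) with `(P, F)`, `(P̄, F̄)` the two base-Frobenius pairs. Naturality
of `F(n) ∈ End(P ↪ C)` along the `P`-arrow `α' : A_N → A_⊙` gives `α = α' ≫ F(n)_{A_⊙}`, and likewise
`ᾱ = ᾱ' ≫ F̄(n̄)_{A_⊙}`; the two endomorphisms `F(n)_{A_⊙}`, `F̄(n̄)_{A_⊙}` of `A_⊙` are base-identity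
isometries of the same Frobenius degree `N`, hence differ by a unit: `F̄(n̄)_{A_⊙} = F(n)_{A_⊙} ≫ x`,
`x ∈ O^×(A_⊙)` ([FrdI] Def. 1.3 (ii); tree `exists_iso_comp_eq_of_div_eq`). The pull-back property of
`ᾱ'` ([FrdI] Def. 1.2 (ii)) lifts the prescribed base isomorphism `Ā'` to `ζ₀ : A_N ⥲ Ā_N` with
`ζ₀ ≫ ᾱ' = α'`, so that `ζ₀ ≫ ᾱ = α ≫ x`; the pull-back property of `α'` lifts `x⁻¹` to a unit `y` of
`A_N` over it (`y ≫ α' = α' ≫ x⁻¹`), which by L05 is an `N`-th power `y = tᴺ` in `O^×(A_N)`; and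
Frobenius-normalization of `A_N` (`t ≫ α'' = α'' ≫ tᴺ`, [FrdI] Def. 1.2 (iv), tree
`ModelFrobenioid.isFrobeniusNormalized`) gives, for `ζ_A := t ≫ ζ₀`,
`ζ_A ≫ ᾱ = t ≫ α ≫ x = α'' ≫ tᴺ ≫ α' ≫ x = α'' ≫ α' ≫ x⁻¹ ≫ x = α` and `Base(ζ_A) = Ā'`. (So [FrdI]
Prop. 5.6, Rmk. 4.1.1 and Thm. 5.1 (iii) are not needed for L06 as typed; conversely, conjugating `(P, F)`
by a family of units produces a second root for which `ζ_A` exists iff the `α'`-pull-back of the unit at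
`A_⊙` is an `N`-th power in `O^×(A_N)`, so L05 is exactly the required input.)

**Consequences**: `prop42_iv_of_unitRootsUpstairs` (every such `S`, modulo the [FrdI] Thm. 5.2 (ii)
dictionary as in `prop42_iv_of_zetaA`) and `prop42_iv_mkOfModelCanonical_of_unitRootsUpstairs`:
**[EtTh] Prop. 4.2 (iv) AS TYPED for the canonical model instance holds modulo `Φ` divisorial and the
single sub-node L05** (which waits on the `(N, H)`-saturation interface of [FrdII] Def. 2.2 (ii),
`IsNHSaturatedBsFld`, TODO-merge abc-iut-L1-t4). HONEST FRAMING: [EtTh] is a refereed prerequisite;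
typed ≠ proved for L05; nothing here takes a side on [IUTchIII] Cor. 3.12.
-/

namespace Literature.AnabelianGeometry.EtaleTheta

open CategoryTheory Opposite Literature.AlgebraicGeometry.Frobenioids

universe u₀ v₀ u v w

variable {K : Type u₀} [Field K]

namespace BiKummerSetting

variable {X : SemiGraphs.TemperedArithmeticGroup.{u₀} K} {D₀ : Type u₀} [Category.{v₀} D₀]
  {V : FrdIMonoidStub.{w}} {T : RealifiedDivisorMonoids (D₀ := D₀) V} {D : Type u} [Category.{v} D]
  {VD : FrdICatStub.{u, v, w} D} (S : BiKummerSetting X T D VD)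

namespace Prop42Sub

variable (pullFrac : ∀ {A A' : S.C} (_ : A' ⟶ A), S.biratUnits A → S.biratUnits A')

/-! ### Model-Frobenioid bookkeeping used by the proof -/

/-- `Base(α) = Base(α')` for `α = α'' ≫ α'` with `α''` base-identity (Def. 4.1 (iv)(c)).
[cite: MochizukiEtTh2009, Def 4.1 p.87] -/
theorem baseMap_eq_baseMap_α₁ {A B : S.C} {α : A ⟶ B} (d : S.BaseFrobeniusTypeData α) :
    ModelFrobenioid.baseMap α = ModelFrobenioid.baseMap d.α₁ := by
  have hc : ModelFrobenioid.baseMap d.α₂ = 𝟙 _ := d.cond_c.1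
  have h := congrArg ModelFrobenioid.baseMap d.fac
  rw [ModelFrobenioid.baseMap_comp, hc, Category.id_comp] at h
  exact h.symm

/-- A morphism `ζ` with `ζ ≫ φ' = φ` for two pull-back morphisms `φ, φ'` is linear with `Div = 0`
(`Φ` divisorial: pull-back morphisms of the model Frobenioid are the linear morphisms with `Div = 0`,
[FrdI] Thm. 5.2 (ii); tree `ModelFrobenioid.degFr_div_of_isPullbackMorphism`).
[cite: MochizukiFrdI2008, Thm. 5.2(ii) p.101] -/
theorem degFr_div_of_comp_pullback (hΦd : Objectwise (fun M _ => IsDivisorial M) S.tf.divisorMonoid)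
    {A A' B : S.C} {φ : A ⟶ B} {φ' : A' ⟶ B} {ζ : A ⟶ A'} (hφ : S.IsPullback φ)
    (hφ' : S.IsPullback φ') (h : ζ ≫ φ' = φ) :
    ModelFrobenioid.degFr ζ = 1 ∧ ModelFrobenioid.div ζ = 1 := by
  obtain ⟨hn, hd⟩ := ModelFrobenioid.degFr_div_of_isPullbackMorphism hΦd hφ
  obtain ⟨hn', hd'⟩ := ModelFrobenioid.degFr_div_of_isPullbackMorphism hΦd hφ'
  have e1 : ModelFrobenioid.degFr φ' * ModelFrobenioid.degFr ζ = ModelFrobenioid.degFr φ := by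
    rw [← ModelFrobenioid.degFr_comp, h]
  have e2 : pull S.tf.divisorMonoid (ModelFrobenioid.baseMap ζ) (ModelFrobenioid.div φ') *
      ModelFrobenioid.div ζ ^ (ModelFrobenioid.degFr φ' : ℕ) = ModelFrobenioid.div φ := by
    rw [← ModelFrobenioid.div_comp_pull, h]
  rw [hn', one_mul, hn] at e1
  rw [hd', map_one, one_mul, hn', PNat.one_coe, pow_one, hd] at e2
  exact ⟨e1, e2⟩

/-- Along a unit `x ∈ O^×(B)`, post-composition does not change `deg_Fr` and `Div` (`Φ` divisorial).
[cite: MochizukiFrdI2008, Thm. 5.2(ii) p.101] -/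
theorem degFr_div_comp_unit (hΦd : Objectwise (fun M _ => IsDivisorial M) S.tf.divisorMonoid)
    {A B : S.C} (φ : A ⟶ B) (x : B ⟶ B) [IsIso x] :
    ModelFrobenioid.degFr (φ ≫ x) = ModelFrobenioid.degFr φ ∧
      ModelFrobenioid.div (φ ≫ x) = ModelFrobenioid.div φ := by
  refine ⟨?_, ModelFrobenioid.div_comp_of_isIso hΦd φ x⟩
  rw [ModelFrobenioid.degFr_comp, ModelFrobenioid.degFr_eq_one_of_isIso x, one_mul]

/-- **Naturality of a Frobenius-section along a distinguished arrow.** For a base-Frobenius pair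
`(P, F)` of `C` ([FrdI] Def. 2.7 (iii)), a `P`-distinguished `α' : A → B` and an `F`-distinguished
`α'' = F(n)_A`, the endomorphism `φ := F(n)_B` of `B` satisfies `α' ≫ φ = α'' ≫ α'` (naturality of
`F(n) ∈ End(P ↪ C)`) and is a base-identity isometry (Def. 2.7 (ii)(b): base-identity of Frobenius type).
[cite: MochizukiFrdI2008, Def. 2.7(ii) p.51] -/
theorem exists_comp_frobenius_of_distinguished {Pr : Presection S.C} {Fr : ℕ+ →* End Pr.ι}
    (hPF : PreFrobenioid.IsBaseFrobeniusPair S.F Pr Fr) {A B : S.C} {α₁ : A ⟶ B} {α₂ : A ⟶ A}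
    (hα₁ : PreFrobenioid.IsDistinguished Pr α₁) (hα₂ : PreFrobenioid.IsFDistinguished Pr Fr α₂) :
    ∃ φ : B ⟶ B, α₁ ≫ φ = α₂ ≫ α₁ ∧ ModelFrobenioid.baseMap φ = 𝟙 _ ∧ ModelFrobenioid.div φ = 1 := by
  obtain ⟨hA, n, hn⟩ := hα₂
  let Ao : Pr.Cat := ⟨B, (Pr.obj_of_hom _ hα₁).2⟩
  refine ⟨(Fr n).app Ao, ?_, hPF.isFrobeniusSection.isBaseIdentity n Ao,
    (hPF.isFrobeniusSection.isFrobeniusType n Ao).1.2⟩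
  have h : α₁ ≫ (Fr n).app Ao = (Fr n).app ⟨A, hA⟩ ≫ α₁ :=
    (Fr n).naturality (X := ⟨A, hA⟩) (Y := Ao) ⟨α₁, hα₁⟩
  have h2 : (Fr n).app ⟨A, hA⟩ ≫ α₁ = α₂ ≫ α₁ := by rw [hn]; rfl
  exact h.trans h2

/-! ### L06 `ZetaA` from L05 `UnitRootsUpstairs` -/

/-- **(iv)/L06 `ZetaA` DISCHARGED from L05** modulo `Φ` divisorial, `B` group-like, for every setting
whose Def. 4.1 (iv)(e) predicate implies the canonical reading `TemperedFrobenioid.ArisesFromBaseFrobeniusPair`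
(a base-Frobenius pair `(P, F)` of `C`, [FrdI] Def. 2.7, with `α'` `P`-distinguished and `α''`
`F`-distinguished): given two `N`-th roots of the same fraction-pair and a base isomorphism
`Ā' : A_N^bs ⥲ Ā_N^bs` with `ᾱ^bs ∘ Ā' = α^bs`, there is `ζ_A : A_N ⥲ Ā_N` with `ᾱ ∘ ζ_A = α` and
`ζ_A^bs = Ā'`. See the module docstring for the proof (naturality of the Frobenius sections along
`α'`, [FrdI] Def. 1.3 (ii) at `A_⊙`, the pull-back property of `α', ᾱ'`, L05, Frobenius-normalization).
[cite: MochizukiEtTh2009, Prop 4.2 p.90] -/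
theorem zetaA_of_unitRootsUpstairs (hΦd : Objectwise (fun M _ => IsDivisorial M) S.tf.divisorMonoid)
    (hBg : Objectwise (fun M _ => IsGroupLike M) S.tf.ratFnFunctor)
    (hE : ∀ {A B : S.C} (G : Subgroup (Aut A)) (α₂ : A ⟶ A) (α₁ : A ⟶ B),
      S.ArisesFromBaseFrobeniusPair G α₂ α₁ → S.tf.ArisesFromBaseFrobeniusPair G α₂ α₁)
    (h₅ : UnitRootsUpstairs S pullFrac) : ZetaA S pullFrac := by
  intro B f P N R R' ebs hebs
  -- the two base-Frobenius pairs `(P, F)`, `(P̄, F̄)` of `C` (Def. 4.1 (iv)(e), canonical reading) and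
  -- the Frobenius endomorphisms `φo = F(n)_{A_⊙}`, `φo' = F̄(n̄)_{A_⊙}`: `α = α' ≫ φo`, `ᾱ = ᾱ' ≫ φo'`
  obtain ⟨Pr, Fr, hPF, -, hα₁, hα₂⟩ := hE _ _ _ R.αData.cond_e
  obtain ⟨Pr', Fr', hPF', -, hα₁', hα₂'⟩ := hE _ _ _ R'.αData.cond_e
  obtain ⟨φo, hnat, hbo, hdo⟩ := exists_comp_frobenius_of_distinguished S hPF hα₁ hα₂
  obtain ⟨φo', hnat', hbo', hdo'⟩ := exists_comp_frobenius_of_distinguished S hPF' hα₁' hα₂'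
  rw [R.αData.fac] at hnat
  rw [R'.αData.fac] at hnat'
  -- `φo`, `φo'` have Frobenius degree `N` (degrees in `α = α' ≫ φo`, `α'` being a pull-back morphism)
  have hp₁ := ModelFrobenioid.degFr_div_of_isPullbackMorphism hΦd R.αData.cond_d
  have hp₁' := ModelFrobenioid.degFr_div_of_isPullbackMorphism hΦd R'.αData.cond_d
  have hN : ModelFrobenioid.degFr R.α = N := R.isIsometry.2.2.1
  have hN' : ModelFrobenioid.degFr R'.α = N := R'.isIsometry.2.2.1
  have hdego : ModelFrobenioid.degFr φo = N := by
    have h := congrArg ModelFrobenioid.degFr hnat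
    rw [ModelFrobenioid.degFr_comp, hp₁.1, mul_one, hN] at h
    exact h
  have hdego' : ModelFrobenioid.degFr φo' = N := by
    have h := congrArg ModelFrobenioid.degFr hnat'
    rw [ModelFrobenioid.degFr_comp, hp₁'.1, mul_one, hN'] at h
    exact h
  -- hence they differ by a unit `x ∈ O^×(A_⊙)`: `φo' = φo ≫ x` ([FrdI] Def. 1.3 (ii) for the model)
  haveI : IsIso (ModelFrobenioid.baseMap φo) := by rw [hbo]; infer_instance
  haveI : IsIso (ModelFrobenioid.baseMap φo') := by rw [hbo']; infer_instance
  obtain ⟨x, hx⟩ := ModelFrobenioid.exists_iso_comp_eq_of_div_eq hBg φo φo'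
    (hdego.trans hdego'.symm) (hdo.trans hdo'.symm)
  have hxb : ModelFrobenioid.baseMap x.hom = 𝟙 _ := by
    have h := congrArg ModelFrobenioid.baseMap hx
    rw [ModelFrobenioid.baseMap_comp, hbo, hbo', Category.id_comp] at h
    exact h
  have hxu : x ∈ S.units S.Aodot := ⟨hxb, ModelFrobenioid.degFr_eq_one_of_isIso x.hom⟩
  have hxsu : x.symm ∈ S.units S.Aodot := by
    have h := (S.units S.Aodot).inv_mem hxu
    rwa [Aut.Aut_inv_def] at h
  have hxib : ModelFrobenioid.baseMap x.inv = 𝟙 _ := hxsu.1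
  -- `Base(α) = Base(α')`, `Base(ᾱ) = Base(ᾱ')`
  have hbα : ModelFrobenioid.baseMap R.α = ModelFrobenioid.baseMap R.αData.α₁ :=
    baseMap_eq_baseMap_α₁ S R.αData
  have hbα' : ModelFrobenioid.baseMap R'.α = ModelFrobenioid.baseMap R'.αData.α₁ :=
    baseMap_eq_baseMap_α₁ S R'.αData
  -- the lift `ζ₀ : A_N → Ā_N` of `Ā'` with `ζ₀ ≫ ᾱ' = α'` (pull-back property of `ᾱ'`), an isomorphism
  have hpb : PreFrobenioid.Base S.F R.αData.α₁ = ebs.hom ≫ PreFrobenioid.Base S.F R'.αData.α₁ := by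
    change ModelFrobenioid.baseMap R.αData.α₁ = ebs.hom ≫ ModelFrobenioid.baseMap R'.αData.α₁
    rw [← hbα, ← hbα']
    exact hebs
  obtain ⟨ζ₀, hζ₀⟩ := (R'.αData.cond_d R.AN).2 ⟨(R.αData.α₁, ebs.hom), hpb⟩
  have e1 : ζ₀ ≫ R'.αData.α₁ = R.αData.α₁ :=
    congrArg (fun p : PreFrobenioid.PullbackHomData S.F R'.αData.α₁ R.AN => p.1.1) hζ₀
  have e2 : ModelFrobenioid.baseMap ζ₀ = ebs.hom :=
    congrArg (fun p : PreFrobenioid.PullbackHomData S.F R'.αData.α₁ R.AN => p.1.2) hζ₀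
  have hζ₀nd := degFr_div_of_comp_pullback S hΦd R.αData.cond_d R'.αData.cond_d e1
  haveI : IsIso (ModelFrobenioid.baseMap ζ₀) := by rw [e2]; infer_instance
  haveI : IsIso ζ₀ := ModelFrobenioid.isIso_of hBg ζ₀ hζ₀nd.2 hζ₀nd.1
  -- the unit `y` of `A_N` over `x⁻¹` along `α'` (pull-back property of `α'`)
  have hpb₂ : PreFrobenioid.Base S.F (R.αData.α₁ ≫ x.inv) =
      𝟙 _ ≫ PreFrobenioid.Base S.F R.αData.α₁ := by
    change ModelFrobenioid.baseMap (R.αData.α₁ ≫ x.inv) = 𝟙 _ ≫ ModelFrobenioid.baseMap R.αData.α₁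
    rw [ModelFrobenioid.baseMap_comp, hxib, Category.comp_id, Category.id_comp]
  obtain ⟨y, hy⟩ := (R.αData.cond_d R.AN).2 ⟨(R.αData.α₁ ≫ x.inv, 𝟙 _), hpb₂⟩
  have e3 : y ≫ R.αData.α₁ = R.αData.α₁ ≫ x.inv :=
    congrArg (fun p : PreFrobenioid.PullbackHomData S.F R.αData.α₁ R.AN => p.1.1) hy
  have e4 : ModelFrobenioid.baseMap y = 𝟙 _ :=
    congrArg (fun p : PreFrobenioid.PullbackHomData S.F R.αData.α₁ R.AN => p.1.2) hy
  have hynd : ModelFrobenioid.degFr y = 1 ∧ ModelFrobenioid.div y = 1 := by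
    have h1 : ModelFrobenioid.degFr (y ≫ R.αData.α₁) = ModelFrobenioid.degFr (R.αData.α₁ ≫ x.inv) := by
      rw [e3]
    have h2 : ModelFrobenioid.div (y ≫ R.αData.α₁) = ModelFrobenioid.div (R.αData.α₁ ≫ x.inv) := by
      rw [e3]
    obtain ⟨hdx, hvx⟩ := degFr_div_comp_unit S hΦd R.αData.α₁ x.inv
    rw [ModelFrobenioid.degFr_comp, hdx, hp₁.1, one_mul] at h1
    rw [ModelFrobenioid.div_comp_pull, hvx, hp₁.2, map_one, one_mul, hp₁.1, PNat.one_coe, pow_one] at h2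
    exact ⟨h1, h2⟩
  haveI : IsIso (ModelFrobenioid.baseMap y) := by rw [e4]; infer_instance
  haveI : IsIso y := ModelFrobenioid.isIso_of hBg y hynd.2 hynd.1
  have hyu : asIso y ∈ S.units R.AN := ⟨e4, hynd.1⟩
  -- L05: `y = tᴺ` for a unit `t` of `A_N`
  have hover : (asIso y).hom ≫ R.αData.α₁ = R.αData.α₁ ≫ x.symm.hom := e3
  obtain ⟨t, htu, htN⟩ := h₅ f P N R x.symm (asIso y) hxsu hyu hover
  have htb : ModelFrobenioid.baseMap t.hom = 𝟙 _ := htu.1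
  -- Frobenius-normalization of `A_N`: `t ≫ α'' = α'' ≫ tᴺ = α'' ≫ y`
  have hdeg₂ : ModelFrobenioid.degFr R.αData.α₂ = N := by
    have h := congrArg ModelFrobenioid.degFr R.αData.fac
    rw [ModelFrobenioid.degFr_comp, hp₁.1, one_mul, hN] at h
    exact h
  have hnorm : t.hom ≫ R.αData.α₂ = R.αData.α₂ ≫ y := by
    have h := PreFrobenioid.unit_comp_eq_comp_pow S.F (ModelFrobenioid.isFrobeniusNormalized R.AN)
      R.αData.cond_c.1 htu
    have hd : (PreFrobenioid.degFr S.F R.αData.α₂ : ℕ) = N := congrArg PNat.val hdeg₂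
    rw [hd, htN] at h
    exact h
  -- `ζ_A := t ≫ ζ₀`
  refine ⟨t ≪≫ asIso ζ₀, ?_, ?_⟩
  · calc (t ≪≫ asIso ζ₀).hom ≫ R'.α = t.hom ≫ ζ₀ ≫ R'.αData.α₁ ≫ φo' := by
          rw [Iso.trans_hom, asIso_hom, Category.assoc, hnat']
      _ = t.hom ≫ R.αData.α₁ ≫ φo ≫ x.hom := by rw [reassoc_of% e1, ← hx]
      _ = t.hom ≫ R.αData.α₂ ≫ R.αData.α₁ ≫ x.hom := by
          rw [reassoc_of% hnat, reassoc_of% R.αData.fac]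
      _ = R.αData.α₂ ≫ R.αData.α₁ ≫ x.inv ≫ x.hom := by rw [reassoc_of% hnorm, reassoc_of% e3]
      _ = R.α := by rw [Iso.inv_hom_id, Category.comp_id, R.αData.fac]
  · ext
    change ModelFrobenioid.baseMap (t.hom ≫ ζ₀) = ebs.hom
    rw [ModelFrobenioid.baseMap_comp, e2, htb, Category.id_comp]

/-- **Prop. 4.2 (iv) AS TYPED ⇐ L05 alone**, for every setting whose Def. 4.1 (iv)(e) predicate implies
the canonical reading, modulo the [FrdI] Thm. 5.2 (ii) facts (`Φ` divisorial, `B` group-like, the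
birational dictionary `toB` with its fraction and transport laws — the hypotheses of
`prop42_iv_of_zetaA`): L06 is `zetaA_of_unitRootsUpstairs`, L07/L07′/L08 are abc-iut-w5-d134's theorems.
[cite: MochizukiEtTh2009, Prop 4.2 p.89] -/
theorem prop42_iv_of_unitRootsUpstairs (hΦd : Objectwise (fun M _ => IsDivisorial M) S.tf.divisorMonoid)
    (hBg : Objectwise (fun M _ => IsGroupLike M) S.tf.ratFnFunctor)
    (toB : ∀ A : S.C, S.biratUnits A →* (S.tf.ratFnFunctor.obj (op A.base))ˣ)
    (hfrac : ∀ {A B : S.C} (s' s'' : A ⟶ B) (h' : S.IsPreStep s') (h'' : S.IsPreStep s'')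
      (hb : PreFrobenioid.BaseEquivalent S.F s' s''),
      (toB A (S.fracOf s' s'' h' h'' hb) : S.tf.ratFnFunctor.obj (op A.base)) *
        ModelFrobenioid.unit s'' = ModelFrobenioid.unit s')
    (hpull : ∀ {A A' : S.C} (φ : A' ⟶ A) (x : S.biratUnits A),
      (toB A' (pullFrac φ x) : S.tf.ratFnFunctor.obj (op A'.base)) =
        pull S.tf.ratFnFunctor (ModelFrobenioid.baseMap φ) (toB A x))
    (hE : ∀ {A B : S.C} (G : Subgroup (Aut A)) (α₂ : A ⟶ A) (α₁ : A ⟶ B),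
      S.ArisesFromBaseFrobeniusPair G α₂ α₁ → S.tf.ArisesFromBaseFrobeniusPair G α₂ α₁)
    (h₅ : UnitRootsUpstairs S pullFrac) : S.Prop42_iv pullFrac :=
  prop42_iv_of_zetaA S pullFrac hΦd hBg toB hfrac hpull (zetaA_of_unitRootsUpstairs S pullFrac hΦd hBg hE h₅)

end Prop42Sub

section Canonical

variable (X) (tf : TemperedFrobenioid T D VD) (hZ : tf.monoidType = MonoidType.Z)
  (hP : ∀ A : Dᵒᵖ, IsPerfect (tf.Φ.carrier A)) (IG : D → Prop) (gS : ∀ A : D, IG A → (X.Pi →* Aut A))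
  (gSs : ∀ (A : D) (h : IG A), Function.Surjective (gS A h))
  (NH : Subgroup (Field.absoluteGaloisGroup K) → tf.category → ℕ+ → Prop) (A₀ : tf.category)
  (hA₀ : PreFrobenioid.IsFrobeniusTrivial tf.toElem A₀) (hA₀' : IG A₀.base)

/-- **L06 `ZetaA` for the CANONICAL MODEL INSTANCE** `mkOfModelCanonical` (abc-iut-L2-t9: Def. 4.1 (iv)(e)
:= `TemperedFrobenioid.ArisesFromBaseFrobeniusPair`, `B₀^Λ` a group by the field `isUnit_BΛ`), modulo `Φ`
divisorial: it follows from the sub-node L05 `UnitRootsUpstairs` at that instance.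
[cite: MochizukiEtTh2009, Prop 4.2 p.90] -/
theorem zetaA_mkOfModelCanonical_of_unitRootsUpstairs
    (hΦd : Objectwise (fun M _ => IsDivisorial M) tf.divisorMonoid)
    (h₅ : Prop42Sub.UnitRootsUpstairs (mkOfModelCanonical X tf hZ hP IG gS gSs NH A₀ hA₀ hA₀')
      (fun φ x => tf.pullFracModel φ x)) :
    Prop42Sub.ZetaA (mkOfModelCanonical X tf hZ hP IG gS gSs NH A₀ hA₀ hA₀')
      (fun φ x => tf.pullFracModel φ x) :=
  Prop42Sub.zetaA_of_unitRootsUpstairs (mkOfModelCanonical X tf hZ hP IG gS gSs NH A₀ hA₀ hA₀')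
    (fun φ x => tf.pullFracModel φ x) hΦd (tf.isGroupLike_ratFnFunctor T.isUnit_BΛ)
    (fun _ _ _ h => h) h₅

/-- **[EtTh] Prop. 4.2 (iv) AS TYPED for the CANONICAL MODEL INSTANCE, modulo the single sub-node L05**
(`Prop42Sub.UnitRootsUpstairs`: pulled-back units of `A_⊙` are `N`-th powers in `O^×(A_N)` — the
`(N, H_⊙, f|_{A_N})`-saturation input of the printed proof, p.90 L14–17) and `Φ` divisorial: L06 by
`zetaA_mkOfModelCanonical_of_unitRootsUpstairs`, the rest by abc-iut-w5-d134's
`prop42_iv_mkOfModel_of_zetaA` (the birational dictionary is the identity for the model).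
[cite: MochizukiEtTh2009, Prop 4.2 p.89] -/
theorem prop42_iv_mkOfModelCanonical_of_unitRootsUpstairs
    (hΦd : Objectwise (fun M _ => IsDivisorial M) tf.divisorMonoid)
    (h₅ : Prop42Sub.UnitRootsUpstairs (mkOfModelCanonical X tf hZ hP IG gS gSs NH A₀ hA₀ hA₀')
      (fun φ x => tf.pullFracModel φ x)) :
    (mkOfModelCanonical X tf hZ hP IG gS gSs NH A₀ hA₀ hA₀').Prop42_iv (fun φ x => tf.pullFracModel φ x) :=
  prop42_iv_mkOfModel_of_zetaA tf hZ hP T.isUnit_BΛ _ IG gS gSs NH _ A₀ hA₀ hA₀' hΦd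
    (zetaA_mkOfModelCanonical_of_unitRootsUpstairs X tf hZ hP IG gS gSs NH A₀ hA₀ hA₀' hΦd h₅)

end Canonical

end BiKummerSetting

end Literature.AnabelianGeometry.EtaleTheta
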